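import Literature.Analysis.Calculus.FlatZeroExtension
import HarnessLib

/-!
# Smooth extension by zero of flat families, jointly in the parameter

Topic `Literature/Analysis/Calculus`. Everything is PROVED; no definitions, no named facts.

`FlatZeroExtension.lean` shows that a `Cⁿ` function on an open ball, extended by zero and with all
derivatives of order `≤ n` tending to `0` at the boundary sphere from inside, is `Cⁿ` on the whole
space (`contDiff_of_flat_sphere`). Here the same is done for FAMILIES `f (p, x)` depending on a
parameter `p` in an open set `N` of a normed space `P`: if `f` is jointly `Cⁿ` on
`N × ball x₀ R`, vanishes for `dist x x₀ ≥ R`, and all its (joint) derivatives of order `≤ n`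
tend to `0` at the points of `N × sphere x₀ R` from inside, then `f` is jointly `Cⁿ` on `N × E`
(`contDiffOn_of_flat_sphere_family`). This is the form in which solutions of boundary-degenerate
elliptic problems on a ball, depending smoothly on parameters and vanishing to all orders at the
boundary, are re-read as smooth compactly supported perturbations jointly in the parameters
(e.g. the output format of the coordinate core `(A)` of
`Literature.Geometry.Lorentzian.ChruscielDelay_localConstraintDeformation_of_coordCore`;
Chruściel–Delay 2003, Cor. 5.11).

Proof: localise in the parameter with a smooth bump `χ` around `p₀` (`ContDiffBump`), apply
`contDiff_of_flat_frontier` to `χ(p) f(p, x)` on the convex open set `ball p₀ ε × ball x₀ R`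
(flat at its frontier: where `χ` vanishes identically this is trivial, elsewhere it is the Leibniz
bound `norm_iteratedFDerivWithin_smul_le` with bounded derivatives of `χ` and vanishing ones of
`f`), and note `χ = 1` near `p₀`.

## References

* P. T. Chruściel, E. Delay, Mém. Soc. Math. Fr. 94 (2003), Cor. 5.11. [ChruscielDelay2003]
-/

noncomputable section

open Set Filter Metric Function
open scoped Topology ContDiff

namespace Literature.Analysis.Calculus

variable {P E F : Type*} [NormedAddCommGroup P] [NormedSpace ℝ P] [HasContDiffBump P]
  [NormedAddCommGroup E] [NormedSpace ℝ E] [NormedAddCommGroup F] [NormedSpace ℝ F] {n : ℕ∞}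

/-- **Flat families extend by zero smoothly, jointly in the parameter.** Let `N ⊆ P` be open,
`0 < R`, and `f : P × E → F` jointly `Cⁿ` on `N × ball x₀ R`, with `f (p, x) = 0` whenever `p ∈ N`
and `R ≤ dist x x₀`, and such that for every `m ≤ n`, every `p ∈ N` and every `x` with
`dist x x₀ = R`, `Dᵐ f (q) → 0` as `q → (p, x)` within `N × ball x₀ R`. Then `f` is jointly `Cⁿ`
on `N × E`. [cite: ChruscielDelay2003, Cor. 5.11] -/
theorem contDiffOn_of_flat_sphere_family {N : Set P} (hN : IsOpen N) {x₀ : E} {R : ℝ} (hR : 0 < R)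
    {f : P × E → F} (hf : ContDiffOn ℝ n f (N ×ˢ ball x₀ R))
    (hzero : ∀ p ∈ N, ∀ x : E, R ≤ dist x x₀ → f (p, x) = 0)
    (hflat : ∀ m : ℕ, (m : ℕ∞) ≤ n → ∀ p ∈ N, ∀ x : E, dist x x₀ = R →
      Tendsto (fun q ↦ iteratedFDeriv ℝ m f q) (𝓝[N ×ˢ ball x₀ R] (p, x)) (𝓝 0)) :
    ContDiffOn ℝ n f (N ×ˢ (univ : Set E)) := by
  rintro ⟨p₀, y₀⟩ ⟨hp₀, -⟩
  -- a parameter ball in `N` and a bump `χ` with `χ = 1` on `closedBall p₀ (ε/4)`,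
  -- `χ = 0` off `ball p₀ (ε/2)`
  obtain ⟨ε, hε, hεN⟩ := Metric.isOpen_iff.1 hN p₀ hp₀
  let χ : ContDiffBump p₀ := ⟨ε / 4, ε / 2, by positivity, by linarith⟩
  have hχrIn : χ.rIn = ε / 4 := rfl
  have hχrOut : χ.rOut = ε / 2 := rfl
  set g : P × E → F := fun q ↦ χ q.1 • f q with hg
  set U : Set (P × E) := ball p₀ ε ×ˢ ball x₀ R with hU
  have hUo : IsOpen U := isOpen_ball.prod isOpen_ball
  have hUc : Convex ℝ U := (convex_ball p₀ ε).prod (convex_ball x₀ R)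
  have hUN : U ⊆ N ×ˢ ball x₀ R := prod_mono hεN Subset.rfl
  have hχn : ContDiff ℝ n (fun q : P × E ↦ χ q.1) := χ.contDiff.comp contDiff_fst
  have hχi : ContDiff ℝ ∞ (fun q : P × E ↦ χ q.1) := χ.contDiff.comp contDiff_fst
  have hgU : ContDiffOn ℝ n g U := hχn.contDiffOn.smul (hf.mono hUN)
  have hχ0 : ∀ p : P, ε / 2 ≤ dist p p₀ → χ p = 0 := fun p hp ↦ χ.zero_of_le_dist hp
  -- `g = 0` off `U`
  have hg0 : ∀ q ∉ U, g q = 0 := by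
    intro q hq
    by_cases hq1 : q.1 ∈ ball p₀ (ε / 2)
    · have hq1' : q.1 ∈ ball p₀ ε := ball_subset_ball (by linarith) hq1
      have hq2 : q.2 ∉ ball x₀ R := fun h ↦ hq ⟨hq1', h⟩
      have hf0 : f q = 0 := by
        have h := hzero q.1 (hεN hq1') q.2 (not_lt.1 fun h ↦ hq2 (mem_ball.2 h))
        exact h
      simp [hg, hf0]
    · have h : χ q.1 = 0 := hχ0 q.1 (not_lt.1 fun h ↦ hq1 (mem_ball.2 h))
      simp [hg, h]
  -- `tsupport g ⊆ closedBall p₀ (ε/2) × E`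
  have htsupp : tsupport g ⊆ closedBall p₀ (ε / 2) ×ˢ (univ : Set E) := by
    refine (tsupport_smul_subset_left _ _).trans (closure_minimal ?_ (isClosed_closedBall.prod isClosed_univ))
    intro q hq
    refine ⟨?_, mem_univ _⟩
    by_contra h
    rw [mem_closedBall, not_le] at h
    exact hq (hχ0 q.1 h.le)
  -- flatness of `g` at the frontier of `U`
  have hflatg : ∀ m : ℕ, (m : ℕ∞) ≤ n → ∀ q ∈ frontier U,
      Tendsto (fun z ↦ iteratedFDeriv ℝ m g z) (𝓝[U] q) (𝓝 0) := by
    intro m hm q hq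
    by_cases hq1 : ε / 2 < dist q.1 p₀
    · -- `g` vanishes identically near `q`
      have hW : ∀ᶠ z in 𝓝 q, iteratedFDeriv ℝ m g z = 0 := by
        have hopen : IsOpen {z : P × E | ε / 2 < dist z.1 p₀} :=
          isOpen_lt continuous_const (continuous_fst.dist continuous_const)
        filter_upwards [hopen.mem_nhds hq1] with z hz
        by_contra hne
        have hz' : z ∈ tsupport g := support_iteratedFDeriv_subset m (mem_support.2 hne)
        exact not_le.2 hz (mem_closedBall.1 (htsupp hz').1)
      have hW' : (fun z ↦ iteratedFDeriv ℝ m g z) =ᶠ[𝓝[U] q] fun _ ↦ 0 :=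
        hW.filter_mono nhdsWithin_le_nhds
      exact tendsto_const_nhds.congr' hW'.symm
    · rw [not_lt] at hq1
      have hq1' : q.1 ∈ ball p₀ ε := mem_ball.2 (lt_of_le_of_lt hq1 (by linarith))
      have hqN : q.1 ∈ N := hεN hq1'
      -- `q.2` is on the sphere
      have hq2 : dist q.2 x₀ = R := by
        rw [hU, frontier_prod_eq] at hq
        rcases hq with ⟨-, h2⟩ | ⟨h1, -⟩
        · rw [frontier_ball x₀ hR.ne'] at h2
          exact h2
        · rw [frontier_ball p₀ hε.ne'] at h1
          exact absurd (mem_sphere.1 h1) (ne_of_lt (mem_ball.1 hq1'))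
      -- Leibniz bound on `U`
      have hbound : ∀ z ∈ U, ‖iteratedFDeriv ℝ m g z‖ ≤ ∑ i ∈ Finset.range (m + 1),
          (m.choose i : ℝ) * ‖iteratedFDeriv ℝ i (fun q : P × E ↦ χ q.1) z‖ *
            ‖iteratedFDeriv ℝ (m - i) f z‖ := by
        intro z hz
        have h := norm_iteratedFDerivWithin_smul_le (𝕜 := ℝ) hχn.contDiffOn (hf.mono hUN)
          hUo.uniqueDiffOn hz (n := m) (mod_cast hm)
        have e1 : ∀ i, iteratedFDerivWithin ℝ i (fun q : P × E ↦ χ q.1) U z =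
            iteratedFDeriv ℝ i (fun q : P × E ↦ χ q.1) z :=
          fun i ↦ iteratedFDerivWithin_of_isOpen i hUo hz
        have e2 : ∀ i, iteratedFDerivWithin ℝ i f U z = iteratedFDeriv ℝ i f z :=
          fun i ↦ iteratedFDerivWithin_of_isOpen i hUo hz
        have e3 : iteratedFDerivWithin ℝ m g U z = iteratedFDeriv ℝ m g z :=
          iteratedFDerivWithin_of_isOpen m hUo hz
        simp only [e1, e2] at h
        rw [e3] at h
        exact h
      -- the right-hand side tends to `0`
      have hrhs : Tendsto (fun z ↦ ∑ i ∈ Finset.range (m + 1),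
          (m.choose i : ℝ) * ‖iteratedFDeriv ℝ i (fun q : P × E ↦ χ q.1) z‖ *
            ‖iteratedFDeriv ℝ (m - i) f z‖) (𝓝[U] q) (𝓝 0) := by
        have h0 : (0 : ℝ) = ∑ i ∈ Finset.range (m + 1),
            (m.choose i : ℝ) * ‖iteratedFDeriv ℝ i (fun q : P × E ↦ χ q.1) q‖ * 0 := by simp
        rw [h0]
        refine tendsto_finsetSum _ fun i _ ↦ (tendsto_const_nhds.mul ?_).mul ?_
        · exact (((hχi.continuous_iteratedFDeriv (m := i) (mod_cast le_top)).tendsto q).mono_left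
            nhdsWithin_le_nhds).norm
        · have hmi : ((m - i : ℕ) : ℕ∞) ≤ n := le_trans (by exact_mod_cast Nat.sub_le m i) hm
          have h := (hflat (m - i) hmi q.1 hqN q.2 hq2).mono_left (nhdsWithin_mono _ hUN)
          exact tendsto_zero_iff_norm_tendsto_zero.1 h
      refine squeeze_zero_norm' ?_ hrhs
      filter_upwards [self_mem_nhdsWithin] with z hz
      exact hbound z hz
  -- `g` is `Cⁿ` everywhere, and `f = g` near `(p₀, y₀)`
  have hgc : ContDiff ℝ n g := contDiff_of_flat_frontier hUo hUc hgU hg0 hflatg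
  have heq : g =ᶠ[𝓝 (p₀, y₀)] f := by
    have h : ∀ᶠ z : P × E in 𝓝 (p₀, y₀), z.1 ∈ ball p₀ (ε / 4) :=
      continuousAt_fst.preimage_mem_nhds (isOpen_ball.mem_nhds (mem_ball_self (by positivity)))
    filter_upwards [h] with z hz
    have h1 : χ z.1 = 1 := χ.one_of_mem_closedBall (ball_subset_closedBall hz)
    simp [hg, h1]
  exact (hgc.contDiffAt.congr_of_eventuallyEq heq.symm).contDiffWithinAt

end Literature.Analysis.Calculus

end
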